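import Literature.MathematicalPhysics.QuantumFieldTheory.TransferDecayUpgrade
import HarnessLib

/-!
# Effective masses of a positive transfer operator decrease to the decay rate ("effective masses are upper bounds")

Theorem-only sequel of `TransferDecayUpgrade.lean` (log-convexity of `n ↦ ⟪v, Tⁿ v⟫` for a positive transfer
operator `T`, `TransferData`; the per-vector decay upgrade).  No definition, no named fact.

AS PRINTED.  For a diagonal Euclidean correlator `C(t) = ⟨0| G(0) G†(t) |0⟩ = Σ_i |c_i|² e^{-m̂_i t}` (eigenstates of
the lattice transfer matrix), the lattice literature reads off masses through the EFFECTIVE MASS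
`m̂_eff(t) = log(C(t-1)/C(t))`: C. Michael, *Hadronic physics from the lattice* (1997), §2 eqs. (2)–(3) and the text
after (3): "`m̂_0 = lim_{t→∞} m̂_eff(t)` … Note that since for the excited states `m̂_i > m̂_0`, then
`m̂_eff(t) > m̂_eff(t+1) > m̂_0`. This implies that the effective mass, defined above, is an upper bound on the ground
state mass … it is worth keeping in mind that upper limits on the ground state mass are obtained in principle";
I. Montvay, G. Münster, *Quantum Fields on a Lattice* (1994), §7.1 eqs. (7.29)–(7.31) (effective masses
`m(t₁, t₂, T)`, "the true mass is given by `m = lim m(t₁, t₂, T)`").  The mechanism is positivity of the spectral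
weights, i.e. of the transfer operator (Glimm–Jaffe 1987 Thm 6.1.3).

PROVED HERE, for `D : TransferData H` (a positive contraction `T`) and any vector `v`, writing `c(n) = re ⟪v, Tⁿ v⟫`
(`≥ 0`, log-convex by `TransferData.re_inner_pow_succ_sq_le`):

* `TransferData.re_inner_pow_pos_of_succ_pos` — `c(n+1) > 0 ⇒ c(n) > 0` (positivity propagates backwards);
* `TransferData.re_inner_pow_ratio_succ_le` — the ratios `c(n+1)/c(n+2) ≤ c(n)/c(n+1)`, and
  ★ `TransferData.effectiveMass_succ_le` — the effective masses `log(c(n)/c(n+1))` are NON-INCREASING in `n`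
  ("`m̂_eff(t) ≥ m̂_eff(t+1)`"; with `≥`, equality being possible for a single exponential);
* ★ `TransferData.neg_log_le_effectiveMass_of_eventually` / `TransferData.le_effectiveMass_of_eventually` — if the
  correlator decays EVENTUALLY at rate `r` (`c(n) ≤ K rⁿ` for large `n`, any constant `K`), resp. at mass `m`
  (`c(n) ≤ K e^{-m n}`), then EVERY effective mass bounds the rate: `-log r ≤ log(c(n)/c(n+1))`, resp.
  `m ≤ log(c(n)/c(n+1))` for all `n` ("the effective mass is an upper bound on the ground state mass" — the mass of
  the lightest state coupling to `v`).

HONEST FRAMING: elementary spectral bookkeeping for positive transfer operators; it certifies the READING RULE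
"measured (effective) masses are upper bounds for the true decay rate in that channel", nothing about any
particular model, and nothing about lower bounds (which effective masses never give).

## References
* C. Michael, *Hadronic Physics from the Lattice*, lectures (1997), arXiv:hep-ph/9710249, §2 eqs. (2)–(3)
  (corpus `paper:arxiv-hep-ph_9710249` p0006). [Michael1997]
* I. Montvay, G. Münster, *Quantum Fields on a Lattice*, CUP (1994), §7.1 (7.29)–(7.31) (corpus p0364).
  [MontvayMunster1994]
* J. Glimm, A. Jaffe, *Quantum Physics* (1987), §6.1 Thm 6.1.3. [GlimmJaffe1987]
-/

open scoped InnerProductSpace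
open Filter

namespace Literature.MathematicalPhysics.QuantumFieldTheory

open Literature.Probability.LatticeModels

section EffectiveMass

variable {H : Type*} [NormedAddCommGroup H] [InnerProductSpace ℂ H]

/-- Positivity of the diagonal correlator propagates backwards in time: `c(n+1) > 0 ⇒ c(n) > 0` (log-convexity
`c(n+1)² ≤ c(n) c(n+2)` and `c ≥ 0`). [cite: GlimmJaffe1987, §6.1 Thm. 6.1.3 (ii)–(iii)] -/
theorem _root_.Literature.Probability.LatticeModels.TransferData.re_inner_pow_pos_of_succ_pos (D : TransferData H)
    (v : H) {n : ℕ} (h : 0 < RCLike.re ⟪v, (D.T ^ (n + 1)) v⟫_ℂ) : 0 < RCLike.re ⟪v, (D.T ^ n) v⟫_ℂ := by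
  rcases (D.re_inner_pow_nonneg v n).eq_or_lt with h0 | h0
  · exfalso
    have hc := D.re_inner_pow_succ_sq_le v n
    rw [← h0, zero_mul] at hc
    nlinarith
  · exact h0

/-- **The ratios `c(n)/c(n+1)` are non-increasing** (`c(n) = re ⟪v, Tⁿ v⟫`): `c(n+1)/c(n+2) ≤ c(n)/c(n+1)` whenever
`c(n+2) > 0` — log-convexity divided through. [cite: GlimmJaffe1987, §6.1 Thm. 6.1.3 (iii)]
[cite: Michael1997, §2 after eq. (3)] -/
theorem _root_.Literature.Probability.LatticeModels.TransferData.re_inner_pow_ratio_succ_le (D : TransferData H)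
    (v : H) {n : ℕ} (h2 : 0 < RCLike.re ⟪v, (D.T ^ (n + 2)) v⟫_ℂ) :
    RCLike.re ⟪v, (D.T ^ (n + 1)) v⟫_ℂ / RCLike.re ⟪v, (D.T ^ (n + 2)) v⟫_ℂ ≤
      RCLike.re ⟪v, (D.T ^ n) v⟫_ℂ / RCLike.re ⟪v, (D.T ^ (n + 1)) v⟫_ℂ := by
  have h1 : 0 < RCLike.re ⟪v, (D.T ^ (n + 1)) v⟫_ℂ := D.re_inner_pow_pos_of_succ_pos v h2
  rw [div_le_div_iff₀ h2 h1]
  have hc := D.re_inner_pow_succ_sq_le v n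
  nlinarith

/-- ★ **Effective masses are non-increasing in time** ("`m̂_eff(t) ≥ m̂_eff(t+1)`"): with
`m_eff(n) = log(c(n)/c(n+1))`, `c(n) = re ⟪v, Tⁿ v⟫`, one has `m_eff(n+1) ≤ m_eff(n)` whenever `c(n+2) > 0`.
[cite: Michael1997, §2 after eq. (3)] [cite: MontvayMunster1994, §7.1 eqs. (7.30)–(7.31)] -/
theorem _root_.Literature.Probability.LatticeModels.TransferData.effectiveMass_succ_le (D : TransferData H)
    (v : H) {n : ℕ} (h2 : 0 < RCLike.re ⟪v, (D.T ^ (n + 2)) v⟫_ℂ) :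
    Real.log (RCLike.re ⟪v, (D.T ^ (n + 1)) v⟫_ℂ / RCLike.re ⟪v, (D.T ^ (n + 2)) v⟫_ℂ) ≤
      Real.log (RCLike.re ⟪v, (D.T ^ n) v⟫_ℂ / RCLike.re ⟪v, (D.T ^ (n + 1)) v⟫_ℂ) := by
  have h1 : 0 < RCLike.re ⟪v, (D.T ^ (n + 1)) v⟫_ℂ := D.re_inner_pow_pos_of_succ_pos v h2
  exact Real.log_le_log (div_pos h1 h2) (D.re_inner_pow_ratio_succ_le v h2)

/-- ★ **Every effective mass bounds the decay rate (rate form).** If `c(n) = re ⟪v, Tⁿ v⟫ ≤ K rⁿ` EVENTUALLY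
(`0 < r`, any constant `K`), then `-log r ≤ log(c(n)/c(n+1))` for every `n` with `c(n+1) > 0`: the decay upgrade
`c(n+1) ≤ r c(n)` (`TransferData.re_inner_pow_succ_le_mul_of_eventually`) read through the logarithm.
[cite: Michael1997, §2 after eq. (3)] [cite: GlimmJaffe1987, §6.1 Thm. 6.1.3 (iii)] -/
theorem _root_.Literature.Probability.LatticeModels.TransferData.neg_log_le_effectiveMass_of_eventually
    (D : TransferData H) (v : H) {r K : ℝ} (hr : 0 < r)
    (h : ∀ᶠ n in atTop, RCLike.re ⟪v, (D.T ^ n) v⟫_ℂ ≤ K * r ^ n) {n : ℕ}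
    (h1 : 0 < RCLike.re ⟪v, (D.T ^ (n + 1)) v⟫_ℂ) :
    -Real.log r ≤ Real.log (RCLike.re ⟪v, (D.T ^ n) v⟫_ℂ / RCLike.re ⟪v, (D.T ^ (n + 1)) v⟫_ℂ) := by
  have hstep := D.re_inner_pow_succ_le_mul_of_eventually v hr h n
  have h0 : 0 < RCLike.re ⟪v, (D.T ^ n) v⟫_ℂ := D.re_inner_pow_pos_of_succ_pos v h1
  rw [← Real.log_inv]
  refine Real.log_le_log (inv_pos.2 hr) ?_
  rw [inv_eq_one_div, div_le_div_iff₀ hr h1]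
  linarith

/-- ★ **Every effective mass bounds the mass from above (mass form):** if `c(n) = re ⟪v, Tⁿ v⟫ ≤ K e^{-m n}`
EVENTUALLY (any constant `K`), then `m ≤ log(c(n)/c(n+1))` for every `n` with `c(n+1) > 0` — "the effective mass
is an upper bound on the ground state mass" (the mass of the lightest state coupling to `v`).
[cite: Michael1997, §2 after eq. (3)] [cite: MontvayMunster1994, §7.1 eq. (7.31)] -/
theorem _root_.Literature.Probability.LatticeModels.TransferData.le_effectiveMass_of_eventually
    (D : TransferData H) (v : H) {m K : ℝ}
    (h : ∀ᶠ n : ℕ in atTop, RCLike.re ⟪v, (D.T ^ n) v⟫_ℂ ≤ K * Real.exp (-(m * (n : ℝ)))) {n : ℕ}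
    (h1 : 0 < RCLike.re ⟪v, (D.T ^ (n + 1)) v⟫_ℂ) :
    m ≤ Real.log (RCLike.re ⟪v, (D.T ^ n) v⟫_ℂ / RCLike.re ⟪v, (D.T ^ (n + 1)) v⟫_ℂ) := by
  have h' : ∀ᶠ k in atTop, RCLike.re ⟪v, (D.T ^ k) v⟫_ℂ ≤ K * Real.exp (-m) ^ k := by
    refine h.mono fun k hk => ?_
    rwa [← Real.exp_nat_mul, mul_neg, mul_comm (k : ℝ) m]
  have := D.neg_log_le_effectiveMass_of_eventually v (Real.exp_pos (-m)) h' h1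
  rwa [Real.log_exp, neg_neg] at this

end EffectiveMass

end Literature.MathematicalPhysics.QuantumFieldTheory
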